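import Literature.MathematicalPhysics.QuantumFieldTheory.Balaban1983to89.B15LayerLocal
import Literature.MathematicalPhysics.QuantumFieldTheory.Balaban1983to89.B11SupSize190

/-!
# `Balaban1983to89.B15LayerSupSize` — the argument-field SIZES of the standard representations ([IV] (1.30), (1.45),
# (1.56), (1.90), p. 199; [III] (3.6), (3.17)) as B-sizes `bB.loc y′ B ≤ m` AT THE SUP SIZE `bB := B11SupSize190.supSize`:
# the input-side dictionary of the cell's (190)-knittings, discharged from the lattice theorems

statement-level skeleton of published theorems with citation tags; proofs where landed; nothing here is a claim about the Yang–Mills mass gap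

CITATION HEADER (lean-in-tree rule 2026-08-18).  T. Bałaban, *Large field renormalization. I. The basic step of the 𝐑
operation*, Commun. Math. Phys. **122** (1989) 175–202, doi:10.1007/BF01257412, bib `Balaban1989LargeFieldI` ("[IV]",
cell paper B15); T. Bałaban, *Convergent renormalization expansions for lattice gauge theories*, Commun. Math. Phys.
**119** (1988) 243–285, doi:10.1007/BF01217741, bib `Balaban1988Convergent` ("[III]", cell paper B14); T. Bałaban, *The
variational problem and background fields in renormalization group method for lattice gauge theories*, Commun. Math.
Phys. **102** (1985) 277–309, bib `Balaban1985Variational` ("[15]" of [III]/[IV]; (190) p. 308 with its sizes *"for x ∈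
Δ(y)"*).  PDFs held (`paper:balaban1989-cmp122-large-field-i`, `paper:balaban1988-cmp119-convergent-renormalization`,
`paper:balaban1985-cmp102-variational-background`); the [IV]/[III] pages were read as images for the companion files.
The papers are manuscripts under adjudication by the audit cell `pub-balaban`; nothing printed is used as a fact here.

WHAT IS REPRODUCED (mega-formalization `lit-balaban`, HOME `run/shared/lean/pub/lit-balaban/`, Phase-2 proof seat p29,
generation 7; SKELETON rows **B15.Eq1.30**, **B15.Eq1.38**, **B15.Eq1.45**, **B15.Eq1.56**, **B15.Eq1.90**, **B15.Eq1.97**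
(fold owner r12) and **B14.Claim@265**, **B14.Eq3.16–3.19** (fold owner r11)).  The cell's (190)-knittings — r11's
`B14Ineq38From190.boundH37_of_ineq190` / `B14Ineq319From190.boundH318_of_ineq190` (and `B14From190SupSize`, p266115),
r12's `B15HDecayLeaves.ineq138_first_of_ineq190` / `ineq145_of_ineq190` / `ineq157_first_of_ineq190` /
`boundH190_of_ineq190` / `boundH199B_of_ineq190` — derive the printed `ℍ`-bounds from [15] (190) for an ABSTRACT
argument vector `B : FB` of an abstract `B11SectG.BlockNorm`, with the printed B-size as the HYPOTHESIS `hm : ∀ y′,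
bB.loc y′ B ≤ m` (`m` = `22d²ε_j`, `4δ′_j`, `44d²B₃ε_k`, `44d²B₃ε_{k+1}`, `11d²ε_h`, `4δ_k` / `30d²L²B₃(1+β₀)ε_k`, `23d²ε_h`).
The companion files of this seat prove these sizes bondwise on the `ℤ^d` carriers (`B15Layer130Lattice` p263483,
`B14ArgField36Lattice` p264453, `B15Layer199Lattice` p265340; local carrier `B15LayerLocal` p266185), and r11's
`B11SupSize190` (p265525) typed [15]'s size *"sup_{x∈Δ(y)}|·|"* as the `BlockNorm` `supSize g box blk` on functions
`X → E` over ANY point set `X`.  THIS FILE closes the input side: for every index set `X` of bonds of the cube tower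
(`dep i ≤ K`, `⟨pt i, pt i + e_{dir i}⟩ ⊂ [tlo (dep i), thi (dep i)]`) the CONCRETE argument field
`B i = (1/i)log[M^{K−dep i}(U)(pt i, dir i)·((Q^{s*}_{dep i}V)(pt i, dir i))⁻¹]` (resp. the two-field ratio of p. 199, resp.
the top-level ratio of (3.3)/(1.27)) satisfies `(supSize g box blk).loc y′ B ≤ m` for EVERY block `y′` and every `box` —
i.e. the `hm` hypotheses hold at `bB := supSize g box blk` — by the local lattice theorems and r11's dictionary lemma
`B11SupSize190.loc_le_of_forall`, used BY NAME.

CONTENTS.  `§1` `argField36_lt_printed_local` (the printed (3.6) layer size `30d²L²B₃(1+β₀)ε_k` on the local carrier —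
the one companion theorem `B15LayerLocal` does not carry);  `§2` the sizes at `supSize`: `loc_argField_le` (generic `2α₁ +
22d²α`, both ratio orders), `loc_layer130_le` (22d²ε_j), `loc_layer156_le` (44d²B₃ε_k), `loc_layer317_le` (44d²B₃ε_{k+1}),
`loc_layer190_le` (11d²ε_h), `loc_top_le` (the top pieces `4δ_k` of (3.6) / `4δ′_j` of (1.38)/(1.45), from (3.3)/(1.27)),
`loc_argField36_le` (`4δ_k + 22d²α`), `loc_argField36_printed_le` (`30d²L²B₃(1+β₀)ε_k`), `loc_layer199_max_le`
(`22d²max{1,X}ε_h + 2δ′_k`), `loc_layer199_le` (`23d²ε_h`).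

HONEST SCOPE.  (1) What is discharged is the SIZE hypothesis `hm` of the knittings at the sup size; their other inputs
((190) itself for the derivatives `dH t`, (2.61) `RowSum`, the localisation distances `hD` — the support of `B` away from
the base block, print's *"equal to 0 / to V″ outside the layer"* geometry —, the mean-value domination `hmv`) are
untouched, and the identification of their abstract `B : FB` with the bond function here is the instantiation `FB := X
→ 𝔸`, `bB := supSize g box blk`.  (2) Strict printed `<` become `≤` sizes (a size hypothesis is `≤`).  (3) Everything
else as in the companion files (tower of cubes ⊇ the printed layers, `M˙` componentwise, `AvgClosed` value group,
smallness explicit, regularity on the finest cube only).  Every declaration is a proved theorem; no `def`, no new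
`Prop` fact; standard axioms.  Unit `lit-balaban-p29` (literature-prover-lit-balaban-p29-g7-0).
-/

noncomputable section

open scoped BigOperators
open NormedSpace Finset

namespace Literature.MathematicalPhysics.QuantumFieldTheory.Balaban1983to89.B15LayerSupSize

open MatrixLog B7Prop1Explicit B7Prop2Explicit B7Prop1Local B8Lemma1NonAbelian B8Ineq129 B8Ineq130 B8Ineq165Descent
  B15Ineq184BlockAxial B15Ineq184Local B8Eq115GaugeFixing B15Layer130Lattice B14ArgField36Lattice B15Layer199Lattice
  B15LayerLocal B11SectG B11SupSize190

-- `Site` alone would resolve to the torus sites of `Setup.lean`; re-export the `ℤ^d` sites of `B7Prop1Explicit`.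
export B7Prop1Explicit (Site)

variable {d : ℕ}

/-! ## §1 The printed (3.6) layer size on the local carrier -/

section PrintedLocal

variable {𝔸 : Type*} [NormedRing 𝔸] [NormOneClass 𝔸] [NormedAlgebra ℂ 𝔸] [CompleteSpace 𝔸]

/-- **`B14ArgField36Lattice.argField36_lt_printed`, LOCAL CARRIER** — [III] p. 266 *"… bounded by 30d²L²B₃(1 + β₀)ε_k on
the k-th layer"* with (3.2) `|U(∂p) − 1| < ε_{k+1}(L⁻¹η)²` assumed on the unit plaquettes of the finest cube only (print:
*"for p ∈ □^{∼3}"*). [cite: Balaban1988Convergent, p.266 (after (3.6)), (3.2)-(3.3) p.265, (2.8) p.256] -/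
theorem argField36_lt_printed_local (L : ℕ) (hL : 2 ≤ L) (hd : 1 ≤ d) {G : Subgroup 𝔸ˣ} (hG : AvgClosed d L G)
    (k : ℕ) (U : Site d → Fin d → 𝔸ˣ) (hU : ∀ x κ, U x κ ∈ G) {εk εk1 δk B₃ β₀ : ℝ} (hε : 0 < εk)
    (hε1 : 0 < εk1) (h28 : εk1 ≤ (1 + β₀) * εk) (hβ₀ : 0 ≤ β₀) (hB₃ : 1 ≤ B₃) (hδ : 0 ≤ δk) (hδε : δk ≤ εk)
    (hs3 : C0 d * εk1 ≤ 1 / 3) (hs2 : 2 * εk1 ≤ c2' d L) (hs : 2 * δk + 11 * (d : ℝ) ^ 2 * εk1 ≤ 1 / 6)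
    (lo hi : Site d) (hlohi : lo ≤ hi)
    (h32 : pdevOn (tlo L lo k) (thi L hi k) U < εk1 * ((L : ℝ)⁻¹ * ((L : ℝ) ^ k)⁻¹) ^ 2)
    (V : Site d → Fin d → 𝔸ˣ) (hV : ∀ x μ, V x μ ∈ U1 𝔸)
    (h15 : ∀ n, n < k → ∀ z, tlo L lo n ≤ z → z ≤ thi L hi n → ∀ r : Fin d → Fin L,
      axialFn (avgIter L U (k - (n + 1))) ((L : ℤ) • z) ((L : ℤ) • z + boxVec L r) = 1)
    (h33 : ∀ x ν, lo ≤ x → x + e ν ≤ hi → ‖((V x ν * (avgIter L U k x ν)⁻¹ : 𝔸ˣ) : 𝔸) - 1‖ < 2 * δk)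
    (n : ℕ) (hn : n ≤ k) (x : Site d) (ν : Fin d) (hx : tlo L lo n ≤ x) (hxν : x + e ν ≤ thi L hi n) :
    ‖mlog (((pullIter L V n x ν * (avgIter L U (k - n) x ν)⁻¹ : 𝔸ˣ) : 𝔸))‖ <
      30 * (d : ℝ) ^ 2 * (L : ℝ) ^ 2 * B₃ * (1 + β₀) * εk := by
  have hL1 : 1 ≤ L := le_trans (by norm_num) hL
  obtain ⟨hW, h32'⟩ := clamp_regular hL1 hG.le_U1 hlohi hU h32
  have h33' : ∀ x ν, lo ≤ x → x + e ν ≤ hi →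
      ‖((V x ν * (avgIter L (clampCfg (tlo L lo k) (thi L hi k) U) k x ν)⁻¹ : 𝔸ˣ) : 𝔸) - 1‖ < 2 * δk :=
    fun x ν hx hxν => by
    rw [avgIter_clamp_eq' hL1 U (j := k) (m := 0) (by simp) (by simpa using hx) (by simpa using hxν)]
    exact h33 x ν hx hxν
  have h := argField36_lt_printed L hL hd hG k _ hW hε hε1 h28 hβ₀ hB₃ hδ hδε hs3 hs2 hs h32' V hV lo hi
    (fun n hn z hz hz' r => by rw [axialFn_clamp_eq' hL1 U hn hz hz' r]; exact h15 n hn z hz hz' r) h33' n hn x ν hx hxν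
  rwa [avgIter_clamp_eq' hL1 U (show n + (k - n) = k by omega) hx hxν] at h

end PrintedLocal

/-! ## §2 The sizes at `bB := supSize g box blk` -/

section SupSize

variable {g : B6.Geometry} {X : Type} (box : g.Site → Finset X) (blk : X → g.Site)
variable {𝔸 : Type} [NormedRing 𝔸] [NormOneClass 𝔸] [NormedAlgebra ℂ 𝔸] [CompleteSpace 𝔸]

/-- **GENERIC SIZE AT THE SUP SIZE**: for an index set `X` of bonds of the cube tower of `k` levels (`dep i ≤ k`,
`⟨pt i, pt i + e_{dir i}⟩ ⊂ [tlo (dep i), thi (dep i)]`), under the hypotheses of `B15LayerLocal.norm_argField_le_local`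
(regularity on the finest cube only, block-axial gauge on the tower, top closeness `α₁` to `V`), the bond function
`B i = log[M^{k−dep i}(U)(pt i, dir i)·((Q^{s*}_{dep i}V)(pt i, dir i))⁻¹]` has `(supSize g box blk).loc y B ≤ 2α₁ + 22d²α` at
every block `y`, for every `box`/`blk` (both ratio orders) — `loc_le_of_forall` over the bondwise bound.
[cite: Balaban1989LargeFieldI, p.183–184 (after (1.30)); Balaban1985Variational, (190) p.308] -/
theorem loc_argField_le (dep : X → ℕ) (pt : X → Site d) (dir : X → Fin d)
    (L : ℕ) (hL : 2 ≤ L) (hd : 1 ≤ d) {G : Subgroup 𝔸ˣ} (hG : AvgClosed d L G)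
    (k : ℕ) (U : Site d → Fin d → 𝔸ˣ) (hU : ∀ x κ, U x κ ∈ G) {α : ℝ} (hα : 0 < α) (hα3 : C0 d * α ≤ 1 / 3)
    (hα2 : 2 * α ≤ c2' d L) (lo hi : Site d) (hlohi : lo ≤ hi)
    (h17 : pdevOn (tlo L lo k) (thi L hi k) U < α * (((L : ℝ) ^ k)⁻¹) ^ 2)
    (V : Site d → Fin d → 𝔸ˣ) (hV : ∀ x μ, V x μ ∈ U1 𝔸) {α₁ : ℝ} (hα₁ : 0 ≤ α₁)
    (hs : α₁ + 11 * (d : ℝ) ^ 2 * α ≤ 1 / 6)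
    (h15 : ∀ n, n < k → ∀ z, tlo L lo n ≤ z → z ≤ thi L hi n → ∀ r : Fin d → Fin L,
      axialFn (avgIter L U (k - (n + 1))) ((L : ℤ) • z) ((L : ℤ) • z + boxVec L r) = 1)
    (htop : ∀ x ν, lo ≤ x → x + e ν ≤ hi → ‖((avgIter L U k x ν : 𝔸ˣ) : 𝔸) - V x ν‖ ≤ α₁)
    (hX : ∀ i, dep i ≤ k ∧ tlo L lo (dep i) ≤ pt i ∧ pt i + e (dir i) ≤ thi L hi (dep i)) (y : g.Site) :
    (supSize g box blk : BlockNorm g (X → 𝔸)).loc y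
        (fun i => mlog (((avgIter L U (k - dep i) (pt i) (dir i) *
          (pullIter L V (dep i) (pt i) (dir i))⁻¹ : 𝔸ˣ) : 𝔸))) ≤ 2 * α₁ + 22 * (d : ℝ) ^ 2 * α ∧
      (supSize g box blk : BlockNorm g (X → 𝔸)).loc y
        (fun i => mlog (((pullIter L V (dep i) (pt i) (dir i) *
          (avgIter L U (k - dep i) (pt i) (dir i))⁻¹ : 𝔸ˣ) : 𝔸))) ≤ 2 * α₁ + 22 * (d : ℝ) ^ 2 * α := by
  have hc : 0 ≤ 2 * α₁ + 22 * (d : ℝ) ^ 2 * α := by positivity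
  have hb := fun i => norm_argField_le_local L hL hd hG k U hU hα hα3 hα2 lo hi hlohi h17 V hV hα₁ hs h15 htop
    (dep i) (hX i).1 (pt i) (dir i) (hX i).2.1 (hX i).2.2
  exact ⟨loc_le_of_forall hc fun i _ => by obtain ⟨h1, -, h3⟩ := hb i; exact h1.trans h3.le,
    loc_le_of_forall hc fun i _ => by obtain ⟨-, h2, h3⟩ := hb i; exact h2.trans h3.le⟩

/-- **[IV] (1.30): the size `22d²ε_j` at the sup size** — the `hm`-type hypothesis for the argument field of `ℍ_{j,□}`
((1.24) c = 1 on the finest cube only, block-axial gauge, top field `V_j = M^j(U)`).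
[cite: Balaban1989LargeFieldI, p.183–184 (after (1.30)); Balaban1985Variational, (190) p.308] -/
theorem loc_layer130_le (dep : X → ℕ) (pt : X → Site d) (dir : X → Fin d)
    (L : ℕ) (hL : 2 ≤ L) (hd : 1 ≤ d) {G : Subgroup 𝔸ˣ} (hG : AvgClosed d L G)
    (j : ℕ) (U : Site d → Fin d → 𝔸ˣ) (hU : ∀ x κ, U x κ ∈ G) {β εj : ℝ} (hβ : 0 ≤ β) (hε : 0 < εj)
    (hε3 : C0 d * εj ≤ 1 / 3) (hε2 : 2 * εj ≤ c2' d L) (hεs : 11 * (d : ℝ) ^ 2 * εj ≤ 1 / 6)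
    (lo hi : Site d) (hlohi : lo ≤ hi)
    (h124 : pdevOn (tlo L lo j) (thi L hi j) U < (1 - β * (1 / 2)) * εj * (((L : ℝ) ^ j)⁻¹) ^ 2)
    (h15 : ∀ n, n < j → ∀ z, tlo L lo n ≤ z → z ≤ thi L hi n → ∀ r : Fin d → Fin L,
      axialFn (avgIter L U (j - (n + 1))) ((L : ℤ) • z) ((L : ℤ) • z + boxVec L r) = 1)
    (hX : ∀ i, dep i ≤ j ∧ tlo L lo (dep i) ≤ pt i ∧ pt i + e (dir i) ≤ thi L hi (dep i)) (y : g.Site) :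
    (supSize g box blk : BlockNorm g (X → 𝔸)).loc y
        (fun i => mlog (((avgIter L U (j - dep i) (pt i) (dir i) *
          (pullIter L (avgIter L U j) (dep i) (pt i) (dir i))⁻¹ : 𝔸ˣ) : 𝔸))) ≤ 22 * (d : ℝ) ^ 2 * εj :=
  loc_le_of_forall (by positivity) fun i _ =>
    (layer130_lt_local L hL hd hG j U hU hβ hε hε3 hε2 hεs lo hi hlohi h124 h15 (dep i) (hX i).1 (pt i) (dir i)
      (hX i).2.1 (hX i).2.2).le

/-- **[IV] (1.56): the size `44d²B₃ε_k` at the sup size** — the `hm` of r12's `B15HDecayLeaves.ineq157_first_of_ineq190`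
for the concrete argument field (plaquette bound `2B₃ε_kη²` on the finest cube only).
[cite: Balaban1989LargeFieldI, p.188 (after (1.56)); Balaban1985Variational, (190) p.308] -/
theorem loc_layer156_le (dep : X → ℕ) (pt : X → Site d) (dir : X → Fin d)
    (L : ℕ) (hL : 2 ≤ L) (hd : 1 ≤ d) {G : Subgroup 𝔸ˣ} (hG : AvgClosed d L G)
    (k : ℕ) (U : Site d → Fin d → 𝔸ˣ) (hU : ∀ x κ, U x κ ∈ G) {B₃ εk : ℝ} (hB₃ : 0 < B₃) (hε : 0 < εk)
    (hs3 : C0 d * (2 * B₃ * εk) ≤ 1 / 3) (hs2 : 2 * (2 * B₃ * εk) ≤ c2' d L)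
    (hs : 11 * (d : ℝ) ^ 2 * (2 * B₃ * εk) ≤ 1 / 6) (lo hi : Site d) (hlohi : lo ≤ hi)
    (h : pdevOn (tlo L lo k) (thi L hi k) U < 2 * B₃ * εk * (((L : ℝ) ^ k)⁻¹) ^ 2)
    (h15 : ∀ n, n < k → ∀ z, tlo L lo n ≤ z → z ≤ thi L hi n → ∀ r : Fin d → Fin L,
      axialFn (avgIter L U (k - (n + 1))) ((L : ℤ) • z) ((L : ℤ) • z + boxVec L r) = 1)
    (hX : ∀ i, dep i ≤ k ∧ tlo L lo (dep i) ≤ pt i ∧ pt i + e (dir i) ≤ thi L hi (dep i)) (y : g.Site) :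
    (supSize g box blk : BlockNorm g (X → 𝔸)).loc y
        (fun i => mlog (((avgIter L U (k - dep i) (pt i) (dir i) *
          (pullIter L (avgIter L U k) (dep i) (pt i) (dir i))⁻¹ : 𝔸ˣ) : 𝔸))) ≤ 44 * (d : ℝ) ^ 2 * B₃ * εk :=
  loc_le_of_forall (by positivity) fun i _ =>
    (layer156_lt_local L hL hd hG k U hU hB₃ hε hs3 hs2 hs lo hi hlohi h h15 (dep i) (hX i).1 (pt i) (dir i)
      (hX i).2.1 (hX i).2.2).le

/-- **[III] (3.17): the size `44d²B₃ε_{k+1}` at the sup size** — the `hm` of r11's `B14Ineq319From190.boundH318_of_ineq190`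
(and of `B14From190SupSize.ineq319_lt_lattice_of_ineq190_sup`) for the concrete argument field of `𝐇_{k+1,□′}` (regularity
`2B₃ε_{k+1}(L⁻¹η)²` on the finest cube only, print *"on Ω_{k+1}"*).
[cite: Balaban1988Convergent, p.268 (after (3.17)); Balaban1985Variational, (190) p.308] -/
theorem loc_layer317_le (dep : X → ℕ) (pt : X → Site d) (dir : X → Fin d)
    (L : ℕ) (hL : 2 ≤ L) (hd : 1 ≤ d) {G : Subgroup 𝔸ˣ} (hG : AvgClosed d L G)
    (K : ℕ) (U : Site d → Fin d → 𝔸ˣ) (hU : ∀ x κ, U x κ ∈ G) {B₃ εk1 : ℝ} (hB₃ : 0 < B₃) (hε : 0 < εk1)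
    (hs3 : C0 d * (2 * B₃ * εk1) ≤ 1 / 3) (hs2 : 2 * (2 * B₃ * εk1) ≤ c2' d L)
    (hs : 11 * (d : ℝ) ^ 2 * (2 * B₃ * εk1) ≤ 1 / 6) (lo hi : Site d) (hlohi : lo ≤ hi)
    (h : pdevOn (tlo L lo K) (thi L hi K) U < 2 * B₃ * εk1 * (((L : ℝ) ^ K)⁻¹) ^ 2)
    (h15 : ∀ n, n < K → ∀ z, tlo L lo n ≤ z → z ≤ thi L hi n → ∀ r : Fin d → Fin L,
      axialFn (avgIter L U (K - (n + 1))) ((L : ℤ) • z) ((L : ℤ) • z + boxVec L r) = 1)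
    (hX : ∀ i, dep i ≤ K ∧ tlo L lo (dep i) ≤ pt i ∧ pt i + e (dir i) ≤ thi L hi (dep i)) (y : g.Site) :
    (supSize g box blk : BlockNorm g (X → 𝔸)).loc y
        (fun i => mlog (((avgIter L U (K - dep i) (pt i) (dir i) *
          (pullIter L (avgIter L U K) (dep i) (pt i) (dir i))⁻¹ : 𝔸ˣ) : 𝔸))) ≤ 44 * (d : ℝ) ^ 2 * B₃ * εk1 :=
  loc_le_of_forall (by positivity) fun i _ =>
    (layer317_lt_local L hL hd hG K U hU hB₃ hε hs3 hs2 hs lo hi hlohi h h15 (dep i) (hX i).1 (pt i) (dir i)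
      (hX i).2.1 (hX i).2.2).le

/-- **[IV] (1.90): the size `11d²ε_h` at the sup size** — the `hm` of r12's `B15HDecayLeaves.boundH190_of_ineq190` for the
concrete argument field of `ℍ_{h,□}` (plaquette bound `½ε_hξ²` on the finest cube only, print *"on □^∼"*).
[cite: Balaban1989LargeFieldI, p.198 (after (1.90)); Balaban1985Variational, (190) p.308] -/
theorem loc_layer190_le (dep : X → ℕ) (pt : X → Site d) (dir : X → Fin d)
    (L : ℕ) (hL : 2 ≤ L) (hd : 1 ≤ d) {G : Subgroup 𝔸ˣ} (hG : AvgClosed d L G)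
    (K : ℕ) (U : Site d → Fin d → 𝔸ˣ) (hU : ∀ x κ, U x κ ∈ G) {εh : ℝ} (hε : 0 < εh)
    (hs3 : C0 d * (εh * (1 / 2)) ≤ 1 / 3) (hs2 : 2 * (εh * (1 / 2)) ≤ c2' d L)
    (hs : 11 * (d : ℝ) ^ 2 * (εh * (1 / 2)) ≤ 1 / 6) (lo hi : Site d) (hlohi : lo ≤ hi)
    (h : pdevOn (tlo L lo K) (thi L hi K) U < εh * (1 / 2) * (((L : ℝ) ^ K)⁻¹) ^ 2)
    (h15 : ∀ n, n < K → ∀ z, tlo L lo n ≤ z → z ≤ thi L hi n → ∀ r : Fin d → Fin L,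
      axialFn (avgIter L U (K - (n + 1))) ((L : ℤ) • z) ((L : ℤ) • z + boxVec L r) = 1)
    (hX : ∀ i, dep i ≤ K ∧ tlo L lo (dep i) ≤ pt i ∧ pt i + e (dir i) ≤ thi L hi (dep i)) (y : g.Site) :
    (supSize g box blk : BlockNorm g (X → 𝔸)).loc y
        (fun i => mlog (((avgIter L U (K - dep i) (pt i) (dir i) *
          (pullIter L (avgIter L U K) (dep i) (pt i) (dir i))⁻¹ : 𝔸ˣ) : 𝔸))) ≤ 11 * (d : ℝ) ^ 2 * εh :=
  loc_le_of_forall (by positivity) fun i _ =>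
    (layer190_lt_local L hL hd hG K U hU hε hs3 hs2 hs lo hi hlohi h h15 (dep i) (hX i).1 (pt i) (dir i)
      (hX i).2.1 (hX i).2.2).le

omit [NormOneClass 𝔸] in
/-- **THE TOP PIECES `4δ` at the sup size** ([III] p. 266 *"On 𝔅_k it is equal to (1/i)log[V_k(V_□^{(k)})⁻¹], hence it can be
bounded by 4δ_k"*; [IV] (1.45) / the first piece of (1.38) with `δ′_j`): for an index set `X` of top-cube bonds, the field
`B i = log[V(pt i, dir i)·(A(pt i, dir i))⁻¹]` of two configurations with `|V_b A_b⁻¹ − 1| < 2δ` on the top cube ((3.3), resp.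
(1.27)), `2δ ≤ ½`, has `(supSize g box blk).loc y B ≤ 4δ` — the `hm₁` of r11's `boundH37_of_ineq190` / the `hm` of r12's
`ineq145_of_ineq190` / the `hm₁` of `ineq138_first_of_ineq190` (`B14ArgField36Lattice.argField36_top_lt`).
[cite: Balaban1988Convergent, p.266 (after (3.6)); Balaban1989LargeFieldI, (1.45) p.186; Balaban1985Variational, (190) p.308] -/
theorem loc_top_le (pt : X → Site d) (dir : X → Fin d) (A V : Site d → Fin d → 𝔸ˣ) {δ : ℝ} (hδ0 : 0 ≤ δ)
    (hδ : 2 * δ ≤ 1 / 2) (lo hi : Site d)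
    (h33 : ∀ x ν, lo ≤ x → x + e ν ≤ hi → ‖((V x ν * (A x ν)⁻¹ : 𝔸ˣ) : 𝔸) - 1‖ < 2 * δ)
    (hX : ∀ i, lo ≤ pt i ∧ pt i + e (dir i) ≤ hi) (y : g.Site) :
    (supSize g box blk : BlockNorm g (X → 𝔸)).loc y
        (fun i => mlog (((V (pt i) (dir i) * (A (pt i) (dir i))⁻¹ : 𝔸ˣ) : 𝔸))) ≤ 4 * δ :=
  loc_le_of_forall (by positivity) fun i _ =>
    (argField36_top_lt (A (pt i) (dir i)) (V (pt i) (dir i)) hδ (h33 (pt i) (dir i) (hX i).1 (hX i).2)).le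

/-- **[III] (3.6), the derived size `4δ_k + 22d²α` at the sup size** (`α = ε_{k+1}L⁻²`-type regularity on the finest cube
only, (3.3) on the top cube, block-axial gauge): `(supSize g box blk).loc y B ≤ 4δ_k + 22d²α` for the concrete field of
(3.6) (`B15LayerLocal.argField36_lt_local`). [cite: Balaban1988Convergent, p.266 (after (3.6)); Balaban1985Variational, (190) p.308] -/
theorem loc_argField36_le (dep : X → ℕ) (pt : X → Site d) (dir : X → Fin d)
    (L : ℕ) (hL : 2 ≤ L) (hd : 1 ≤ d) {G : Subgroup 𝔸ˣ} (hG : AvgClosed d L G)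
    (k : ℕ) (U : Site d → Fin d → 𝔸ˣ) (hU : ∀ x κ, U x κ ∈ G) {α : ℝ} (hα : 0 < α) (hα3 : C0 d * α ≤ 1 / 3)
    (hα2 : 2 * α ≤ c2' d L) (lo hi : Site d) (hlohi : lo ≤ hi)
    (h32 : pdevOn (tlo L lo k) (thi L hi k) U < α * (((L : ℝ) ^ k)⁻¹) ^ 2)
    (V : Site d → Fin d → 𝔸ˣ) (hV : ∀ x μ, V x μ ∈ U1 𝔸) {δk : ℝ} (hδ : 0 ≤ δk)
    (hs : 2 * δk + 11 * (d : ℝ) ^ 2 * α ≤ 1 / 6)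
    (h15 : ∀ n, n < k → ∀ z, tlo L lo n ≤ z → z ≤ thi L hi n → ∀ r : Fin d → Fin L,
      axialFn (avgIter L U (k - (n + 1))) ((L : ℤ) • z) ((L : ℤ) • z + boxVec L r) = 1)
    (h33 : ∀ x ν, lo ≤ x → x + e ν ≤ hi → ‖((V x ν * (avgIter L U k x ν)⁻¹ : 𝔸ˣ) : 𝔸) - 1‖ < 2 * δk)
    (hX : ∀ i, dep i ≤ k ∧ tlo L lo (dep i) ≤ pt i ∧ pt i + e (dir i) ≤ thi L hi (dep i)) (y : g.Site) :
    (supSize g box blk : BlockNorm g (X → 𝔸)).loc y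
        (fun i => mlog (((pullIter L V (dep i) (pt i) (dir i) *
          (avgIter L U (k - dep i) (pt i) (dir i))⁻¹ : 𝔸ˣ) : 𝔸))) ≤ 4 * δk + 22 * (d : ℝ) ^ 2 * α :=
  loc_le_of_forall (by positivity) fun i _ => by
    obtain ⟨h1, h2⟩ := argField36_lt_local L hL hd hG k U hU hα hα3 hα2 lo hi hlohi h32 V hV hδ hs h15 h33 (dep i)
      (hX i).1 (pt i) (dir i) (hX i).2.1 (hX i).2.2
    exact h1.trans h2.le

/-- **[III] (3.6), the PRINTED layer size `30d²L²B₃(1+β₀)ε_k` at the sup size** — the `hm₂` of r11's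
`B14Ineq38From190.boundH37_of_ineq190` for the concrete argument field of (3.6) ((3.2) on the finest cube only, (3.3) on the
top cube, (2.8), `δ_k ≤ ε_k`, `B₃ ≥ 1`; `argField36_lt_printed_local`).
[cite: Balaban1988Convergent, p.266 (after (3.6)); Balaban1985Variational, (190) p.308] -/
theorem loc_argField36_printed_le (dep : X → ℕ) (pt : X → Site d) (dir : X → Fin d)
    (L : ℕ) (hL : 2 ≤ L) (hd : 1 ≤ d) {G : Subgroup 𝔸ˣ} (hG : AvgClosed d L G)
    (k : ℕ) (U : Site d → Fin d → 𝔸ˣ) (hU : ∀ x κ, U x κ ∈ G) {εk εk1 δk B₃ β₀ : ℝ} (hε : 0 < εk)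
    (hε1 : 0 < εk1) (h28 : εk1 ≤ (1 + β₀) * εk) (hβ₀ : 0 ≤ β₀) (hB₃ : 1 ≤ B₃) (hδ : 0 ≤ δk) (hδε : δk ≤ εk)
    (hs3 : C0 d * εk1 ≤ 1 / 3) (hs2 : 2 * εk1 ≤ c2' d L) (hs : 2 * δk + 11 * (d : ℝ) ^ 2 * εk1 ≤ 1 / 6)
    (lo hi : Site d) (hlohi : lo ≤ hi)
    (h32 : pdevOn (tlo L lo k) (thi L hi k) U < εk1 * ((L : ℝ)⁻¹ * ((L : ℝ) ^ k)⁻¹) ^ 2)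
    (V : Site d → Fin d → 𝔸ˣ) (hV : ∀ x μ, V x μ ∈ U1 𝔸)
    (h15 : ∀ n, n < k → ∀ z, tlo L lo n ≤ z → z ≤ thi L hi n → ∀ r : Fin d → Fin L,
      axialFn (avgIter L U (k - (n + 1))) ((L : ℤ) • z) ((L : ℤ) • z + boxVec L r) = 1)
    (h33 : ∀ x ν, lo ≤ x → x + e ν ≤ hi → ‖((V x ν * (avgIter L U k x ν)⁻¹ : 𝔸ˣ) : 𝔸) - 1‖ < 2 * δk)
    (hX : ∀ i, dep i ≤ k ∧ tlo L lo (dep i) ≤ pt i ∧ pt i + e (dir i) ≤ thi L hi (dep i)) (y : g.Site) :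
    (supSize g box blk : BlockNorm g (X → 𝔸)).loc y
        (fun i => mlog (((pullIter L V (dep i) (pt i) (dir i) *
          (avgIter L U (k - dep i) (pt i) (dir i))⁻¹ : 𝔸ˣ) : 𝔸))) ≤
      30 * (d : ℝ) ^ 2 * (L : ℝ) ^ 2 * B₃ * (1 + β₀) * εk := by
  have hB : (0 : ℝ) ≤ B₃ := zero_le_one.trans hB₃
  exact loc_le_of_forall (by positivity) fun i _ =>
    (argField36_lt_printed_local L hL hd hG k U hU hε hε1 h28 hβ₀ hB₃ hδ hδε hs3 hs2 hs lo hi hlohi h32 V hV h15 h33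
      (dep i) (hX i).1 (pt i) (dir i) (hX i).2.1 (hX i).2.2).le

/-- **[IV] p. 199, the first member `22d²max{1,X}ε_h + 2δ′_k` at the sup size** — for the concrete two-field argument field
of the layer `Σ` (`B15LayerLocal.layer199_lt_max_local`: (1.96)/(1.80) on the finest cube of the `h`-tower only, (D),
relative axial gauge, (1.81)/(1.82) top closeness). [cite: Balaban1989LargeFieldI, p.199 (after (1.96)); Balaban1985Variational, (190) p.308] -/
theorem loc_layer199_max_le (dep : X → ℕ) (pt : X → Site d) (dir : X → Fin d)
    (L : ℕ) (hL : 2 ≤ L) (hd : 1 ≤ d) {G : Subgroup 𝔸ˣ} (hG : AvgClosed d L G)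
    {h k : ℕ} (hhk : h ≤ k) (U₀ U : Site d → Fin d → 𝔸ˣ) (hU₀ : ∀ x κ, U₀ x κ ∈ G) (hU : ∀ x κ, U x κ ∈ G)
    {εh εk δk C β₀ Xc : ℝ} (hε : 0 < εh) (hC : 0 ≤ C) (hδ0 : 0 ≤ δk) (lo hi : Site d) (hlohi : lo ≤ hi)
    (h96 : pdevOn (tlo L lo h) (thi L hi h) U < 3 / 4 * εh * (((L : ℝ) ^ h)⁻¹) ^ 2)
    (h80 : pdevOn (tlo L lo h) (thi L hi h) U₀ < C * εk * (((L : ℝ) ^ k)⁻¹) ^ 2)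
    (hD : εk ≤ (1 + β₀) * Real.sqrt (k - h : ℕ) * εh)
    (hXc : Xc = (((L : ℝ) ^ (k - h)) ^ 2)⁻¹ * Real.sqrt (k - h : ℕ) * C * (1 + β₀))
    (hs3 : C0 d * (max 1 Xc * εh) ≤ 1 / 3) (hs2 : 2 * (max 1 Xc * εh) ≤ c2' d L)
    (hs6 : 11 * (d : ℝ) ^ 2 * (max 1 Xc * εh) + δk ≤ 1 / 6)
    (h19 : ∀ n, n < h → ∀ z, tlo L lo n ≤ z → z ≤ thi L hi n → ∀ r : Fin d → Fin L,
      axialFn (avgIter L U (h - (n + 1))) ((L : ℤ) • z) ((L : ℤ) • z + boxVec L r) =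
        axialFn (avgIter L U₀ (h - (n + 1))) ((L : ℤ) • z) ((L : ℤ) • z + boxVec L r))
    (h82 : ∀ x ν, lo ≤ x → x + e ν ≤ hi →
      ‖((avgIter L U h x ν * (avgIter L U₀ h x ν)⁻¹ : 𝔸ˣ) : 𝔸) - 1‖ ≤ δk)
    (hX : ∀ i, dep i ≤ h ∧ tlo L lo (dep i) ≤ pt i ∧ pt i + e (dir i) ≤ thi L hi (dep i)) (y : g.Site) :
    (supSize g box blk : BlockNorm g (X → 𝔸)).loc y
        (fun i => mlog (((avgIter L U (h - dep i) (pt i) (dir i) *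
          (avgIter L U₀ (h - dep i) (pt i) (dir i))⁻¹ : 𝔸ˣ) : 𝔸))) ≤ 22 * (d : ℝ) ^ 2 * max 1 Xc * εh + 2 * δk := by
  have hmax : (0 : ℝ) ≤ max 1 Xc := zero_le_one.trans (le_max_left 1 Xc)
  exact loc_le_of_forall (by positivity) fun i _ =>
    (layer199_lt_max_local L hL hd hG hhk U₀ U hU₀ hU hε hC hδ0 lo hi hlohi h96 h80 hD hXc hs3 hs2 hs6 h19 h82
      (dep i) (hX i).1 (pt i) (dir i) (hX i).2.1 (hX i).2.2).1.le

/-- **[IV] p. 199, the size `23d²ε_h` at the sup size** — the `hm` of r12's `B15HDecayLeaves.boundH199B_of_ineq190` for the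
concrete two-field argument field of the layer `Σ` (`B15LayerLocal.layer199_lt_local`).
[cite: Balaban1989LargeFieldI, p.199 (after (1.96)); Balaban1985Variational, (190) p.308] -/
theorem loc_layer199_le (dep : X → ℕ) (pt : X → Site d) (dir : X → Fin d)
    (L : ℕ) (hL : 2 ≤ L) (hd : 1 ≤ d) {G : Subgroup 𝔸ˣ} (hG : AvgClosed d L G)
    {h k : ℕ} (hhk : h ≤ k) (U₀ U : Site d → Fin d → 𝔸ˣ) (hU₀ : ∀ x κ, U₀ x κ ∈ G) (hU : ∀ x κ, U x κ ∈ G)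
    {εh εk δk C β₀ Xc r : ℝ} (hε : 0 < εh) (hC : 0 ≤ C) (hδ0 : 0 ≤ δk) (lo hi : Site d) (hlohi : lo ≤ hi)
    (h96 : pdevOn (tlo L lo h) (thi L hi h) U < 3 / 4 * εh * (((L : ℝ) ^ h)⁻¹) ^ 2)
    (h80 : pdevOn (tlo L lo h) (thi L hi h) U₀ < C * εk * (((L : ℝ) ^ k)⁻¹) ^ 2)
    (hD : εk ≤ (1 + β₀) * Real.sqrt (k - h : ℕ) * εh)
    (hXc : Xc = (((L : ℝ) ^ (k - h)) ^ 2)⁻¹ * Real.sqrt (k - h : ℕ) * C * (1 + β₀)) (hX1 : Xc ≤ 1)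
    (hδ : δk ≤ (1 + β₀) * Real.sqrt (k - h : ℕ) * r * εh)
    (hsmall : 2 * (1 + β₀) * Real.sqrt (k - h : ℕ) * r < (d : ℝ) ^ 2)
    (hs3 : C0 d * εh ≤ 1 / 3) (hs2 : 2 * εh ≤ c2' d L) (hs6 : 11 * (d : ℝ) ^ 2 * εh + δk ≤ 1 / 6)
    (h19 : ∀ n, n < h → ∀ z, tlo L lo n ≤ z → z ≤ thi L hi n → ∀ r : Fin d → Fin L,
      axialFn (avgIter L U (h - (n + 1))) ((L : ℤ) • z) ((L : ℤ) • z + boxVec L r) =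
        axialFn (avgIter L U₀ (h - (n + 1))) ((L : ℤ) • z) ((L : ℤ) • z + boxVec L r))
    (h82 : ∀ x ν, lo ≤ x → x + e ν ≤ hi →
      ‖((avgIter L U h x ν * (avgIter L U₀ h x ν)⁻¹ : 𝔸ˣ) : 𝔸) - 1‖ ≤ δk)
    (hX : ∀ i, dep i ≤ h ∧ tlo L lo (dep i) ≤ pt i ∧ pt i + e (dir i) ≤ thi L hi (dep i)) (y : g.Site) :
    (supSize g box blk : BlockNorm g (X → 𝔸)).loc y
        (fun i => mlog (((avgIter L U (h - dep i) (pt i) (dir i) *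
          (avgIter L U₀ (h - dep i) (pt i) (dir i))⁻¹ : 𝔸ˣ) : 𝔸))) ≤ 23 * (d : ℝ) ^ 2 * εh :=
  loc_le_of_forall (by positivity) fun i _ =>
    (layer199_lt_local L hL hd hG hhk U₀ U hU₀ hU hε hC hδ0 lo hi hlohi h96 h80 hD hXc hX1 hδ hsmall hs3 hs2 hs6 h19
      h82 (dep i) (hX i).1 (pt i) (dir i) (hX i).2.1 (hX i).2.2).1.le

end SupSize

/-! ## §3 (v1.1, append-only) [IV] p. 185: the `Ω_{j+1} ∩ Z^c_j` piece of (1.34)/(1.38)₁ (`≤ 22d²ε_j`), local carrier and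
at the sup size -/

section Zc

variable {𝔸 : Type*} [NormedRing 𝔸] [NormOneClass 𝔸] [NormedAlgebra ℂ 𝔸] [CompleteSpace 𝔸]

/-- **`B14ArgField36Lattice.layer138_Zc_lt`, LOCAL CARRIER** — [IV] p. 185 l. 7–8 *"On the boundary layer it can be
bounded by 22d²ε_j."*: (1.24) (c = 1) `|U(∂p) − 1| < ε_jξ²` assumed on the unit plaquettes of the finest cube only, (1.27)
`|V(b)(M^j(U)(b))⁻¹ − 1| < 2δ′_j` on the top cube, `6δ′_j ≤ ε_j`, block-axial gauge on the tower: both ratio orders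
`≤ 22d²ε_j` (`≤`, not `<`: the slack of `2(2δ′_j + 8d²ε_j·4/3)` against `22d²ε_j` is exactly `4δ′_j` at `6δ′_j = ε_j`,
`d = 1`). [cite: Balaban1989LargeFieldI, p.185 (before (1.38)), (1.27) p.183] -/
theorem layer138_Zc_le_local (L : ℕ) (hL : 2 ≤ L) (hd : 1 ≤ d) {G : Subgroup 𝔸ˣ} (hG : AvgClosed d L G)
    (j : ℕ) (U : Site d → Fin d → 𝔸ˣ) (hU : ∀ x κ, U x κ ∈ G) {εj δ'j : ℝ} (hε : 0 < εj) (hε3 : C0 d * εj ≤ 1 / 3)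
    (hε2 : 2 * εj ≤ c2' d L) (lo hi : Site d) (hlohi : lo ≤ hi)
    (h124 : pdevOn (tlo L lo j) (thi L hi j) U < εj * (((L : ℝ) ^ j)⁻¹) ^ 2)
    (V : Site d → Fin d → 𝔸ˣ) (hV : ∀ x μ, V x μ ∈ U1 𝔸) (hδ : 0 ≤ δ'j) (hδε : 6 * δ'j ≤ εj)
    (hs : 2 * δ'j + 11 * (d : ℝ) ^ 2 * εj ≤ 1 / 6)
    (h15 : ∀ n, n < j → ∀ z, tlo L lo n ≤ z → z ≤ thi L hi n → ∀ r : Fin d → Fin L,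
      axialFn (avgIter L U (j - (n + 1))) ((L : ℤ) • z) ((L : ℤ) • z + boxVec L r) = 1)
    (h127 : ∀ x ν, lo ≤ x → x + e ν ≤ hi → ‖((V x ν * (avgIter L U j x ν)⁻¹ : 𝔸ˣ) : 𝔸) - 1‖ < 2 * δ'j)
    (n : ℕ) (hn : n ≤ j) (x : Site d) (ν : Fin d) (hx : tlo L lo n ≤ x) (hxν : x + e ν ≤ thi L hi n) :
    ‖mlog (((avgIter L U (j - n) x ν * (pullIter L V n x ν)⁻¹ : 𝔸ˣ) : 𝔸))‖ ≤ 22 * (d : ℝ) ^ 2 * εj ∧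
      ‖mlog (((pullIter L V n x ν * (avgIter L U (j - n) x ν)⁻¹ : 𝔸ˣ) : 𝔸))‖ ≤ 22 * (d : ℝ) ^ 2 * εj := by
  have hL1 : 1 ≤ L := le_trans (by norm_num) hL
  obtain ⟨hW, h124'⟩ := clamp_regular hL1 hG.le_U1 hlohi hU h124
  have h127' : ∀ x ν, lo ≤ x → x + e ν ≤ hi →
      ‖((V x ν * (avgIter L (clampCfg (tlo L lo j) (thi L hi j) U) j x ν)⁻¹ : 𝔸ˣ) : 𝔸) - 1‖ < 2 * δ'j :=
    fun x ν hx hxν => by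
    rw [avgIter_clamp_eq' hL1 U (j := j) (m := 0) (by simp) (by simpa using hx) (by simpa using hxν)]
    exact h127 x ν hx hxν
  have h := layer138_Zc_lt L hL hd hG j _ hW hε hε3 hε2 h124' V hV hδ hδε hs lo hi
    (fun n hn z hz hz' r => by rw [axialFn_clamp_eq' hL1 U hn hz hz' r]; exact h15 n hn z hz hz' r) h127' n hn x ν hx hxν
  rwa [avgIter_clamp_eq' hL1 U (show n + (j - n) = j by omega) hx hxν] at h

end Zc

section ZcSup

variable {g : B6.Geometry} {X : Type} (box : g.Site → Finset X) (blk : X → g.Site)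
variable {𝔸 : Type} [NormedRing 𝔸] [NormOneClass 𝔸] [NormedAlgebra ℂ 𝔸] [CompleteSpace 𝔸]

/-- **[IV] (1.38)₁, the `Z^c_j`-layer size `22d²ε_j` at the sup size** — the `hm₂`-type hypothesis of r12's
`B15HDecayLeaves.ineq138_first_of_ineq190` (there written with the letter of the relevant scale) for the concrete argument
field of (1.34) on the `Z^c_j` blocks (`layer138_Zc_le_local`); the top piece `4δ′_j` is `loc_top_le`, the `Z_{j+1}` piece
`22d²ε_{j+1}` is `loc_layer130_le` one scale up. [cite: Balaban1989LargeFieldI, p.185 (before (1.38)); Balaban1985Variational, (190) p.308] -/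
theorem loc_layer138_Zc_le (dep : X → ℕ) (pt : X → Site d) (dir : X → Fin d)
    (L : ℕ) (hL : 2 ≤ L) (hd : 1 ≤ d) {G : Subgroup 𝔸ˣ} (hG : AvgClosed d L G)
    (j : ℕ) (U : Site d → Fin d → 𝔸ˣ) (hU : ∀ x κ, U x κ ∈ G) {εj δ'j : ℝ} (hε : 0 < εj) (hε3 : C0 d * εj ≤ 1 / 3)
    (hε2 : 2 * εj ≤ c2' d L) (lo hi : Site d) (hlohi : lo ≤ hi)
    (h124 : pdevOn (tlo L lo j) (thi L hi j) U < εj * (((L : ℝ) ^ j)⁻¹) ^ 2)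
    (V : Site d → Fin d → 𝔸ˣ) (hV : ∀ x μ, V x μ ∈ U1 𝔸) (hδ : 0 ≤ δ'j) (hδε : 6 * δ'j ≤ εj)
    (hs : 2 * δ'j + 11 * (d : ℝ) ^ 2 * εj ≤ 1 / 6)
    (h15 : ∀ n, n < j → ∀ z, tlo L lo n ≤ z → z ≤ thi L hi n → ∀ r : Fin d → Fin L,
      axialFn (avgIter L U (j - (n + 1))) ((L : ℤ) • z) ((L : ℤ) • z + boxVec L r) = 1)
    (h127 : ∀ x ν, lo ≤ x → x + e ν ≤ hi → ‖((V x ν * (avgIter L U j x ν)⁻¹ : 𝔸ˣ) : 𝔸) - 1‖ < 2 * δ'j)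
    (hX : ∀ i, dep i ≤ j ∧ tlo L lo (dep i) ≤ pt i ∧ pt i + e (dir i) ≤ thi L hi (dep i)) (y : g.Site) :
    (supSize g box blk : BlockNorm g (X → 𝔸)).loc y
        (fun i => mlog (((pullIter L V (dep i) (pt i) (dir i) *
          (avgIter L U (j - dep i) (pt i) (dir i))⁻¹ : 𝔸ˣ) : 𝔸))) ≤ 22 * (d : ℝ) ^ 2 * εj :=
  loc_le_of_forall (by positivity) fun i _ =>
    (layer138_Zc_le_local L hL hd hG j U hU hε hε3 hε2 lo hi hlohi h124 V hV hδ hδε hs h15 h127 (dep i) (hX i).1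
      (pt i) (dir i) (hX i).2.1 (hX i).2.2).2

end ZcSup

end Literature.MathematicalPhysics.QuantumFieldTheory.Balaban1983to89.B15LayerSupSize
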